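import Summits.AtomisticToContinuum.HydrodynamicLimit.Theorems.RelayRaceLocalityNearConstantShortTimeHLWindowEstimate
import Summits.AtomisticToContinuum.HydrodynamicLimit.Theorems.RelayRaceLocalityNearConstantShortTimeHLWindowPathwise
import Summits.AtomisticToContinuum.HydrodynamicLimit.Theorems.RelayRaceLocalityNearConstantShortTimeHLFlowFubini
import Summits.AtomisticToContinuum.HydrodynamicLimit.Theorems.RelayRaceLocalityNearConstantShortTimeHLGaussianTail
import HarnessLib

/-!
# Crux `NearConstantShortTimeHL` (stmt-AtomisticToContinuum-12502), line `small-tilt-domination`: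
# stub `grid_increments` — the grid integral inequality of the relative-entropy Grönwall

Support file for the crux `…Theses.RelayRaceLocality.NearConstantShortTimeHL`, line `small-tilt-domination`
(route: Yau's relative-entropy method, Grönwall assembly `stub_dynamic`; lead c6, wave 3), registered stub
**`grid_increments`** (a package of `stub_dynamic`).

Along a classical hard-sphere–Euler solution in the analyticity band on `[0, t]`, for a hard-sphere flow `Φ`,
a probability law `P ≪ Liouville`, a grid `r_k = k · (t/ι)` and a measurable good event `G'` on which the
ball-packing cap holds on `[0, t]` and the closure defects of the windows `[0, r_k]` are `≤ d`, the entropy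
deficit `D(r) = m^{st}(r) − E_P[X_r ∘ Φ_r]` (`m^{st}` the static Euler mean of the log-profile, `X_r` the
log-profile observable) is interval-integrable on `[0, t]` and satisfies at every grid point

`D(r_k) ≤ max 0 D(0) + C(1+L)βκ′t + C t Tl + 2d + 6tω(1 + E_P K) + 2 CX E_P[(1+K); G'ᶜ] + C t P(G'ᶜ)`
`        + C(1+L)β ∫_0^{r_k} D`,

given the entropy domination `E_P[fluctuationE_r ∘ Φ_r] ≤ β (D(r) + κ′)` on `[0, t]`.

Proof (pure composition of landed pieces):
* the pathwise window bound `window_pathwise` on the window `[0, r_k]` (good orbits in `G'`) feeds the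
  expectation-level `window_estimate` with `X = logProfileObs`, `mst = m^{st}`, prices `fluctuationE`,
  `cubicTail L`, `C₃ = 6 r_k ω` and `CE = C t` (`|m^{st}(r_k) − m^{st}(0)| ≤ C t` from the Euler side
  `integral_logProfileStatic_sub_eq`, whose rate is continuous hence bounded on `[0, t]`);
* Fubini along the flow (`integral_integral_flow_swap`; joint measurability is the clamped-time hypothesis,
  domination by `2 + K`, `CX(1 + K)` resp. `2K + 4nK²` — `xw_cubicTail_le` — with `K` conserved along good
  orbits, `wc_kineticPP_flow`) turns `E_P ∫_0^{r_k}` into `∫_0^{r_k} E_P`, where the domination hypothesis and the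
  cubic-tail bound `Tl` apply; it also gives the interval integrability of `r ↦ E_P[X_r ∘ Φ_r]`, while
  `m^{st}` is continuous on `[0, t]` (a primitive of the continuous Euler rate);
* elementary arithmetic (`xw_grid_core`).

Helpers are prefixed `xw_`. No definitions, no named facts.
References: H.-T. Yau, Lett. Math. Phys. 22 (1991) §2.
-/

noncomputable section

namespace Summit.AtomisticToContinuum.HydrodynamicLimit.Theorems.NearConstantShortTimeHL

open MeasureTheory Filter Set Topology
open Literature.MathematicalPhysics.KineticTheory Literature.Analysis.FluidPDE Literature.Analysis.FunctionSpaces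
open scoped ENNReal BigOperators

/-! ## Helpers -/

/-- **The cubic tail is dominated by the kinetic energy and its square**: `n⁻¹ Σᵢ ‖vᵢ‖³ 𝟙{‖vᵢ‖ > L} ≤ 2K + 4nK²`
(`‖vᵢ‖² ≤ Σⱼ ‖vⱼ‖² = 2nK`, `‖v‖ ≤ 1 + ‖v‖²`). Crude in `n`, but an everywhere bound by a conserved, integrable
quantity — all that Fubini along the flow needs. [folklore] -/
theorem xw_cubicTail_le {n : ℕ} (hn : n ≠ 0) (L : ℝ) (w : Config n (Fin 3) T3) :
    cubicTail L w ≤ 2 * kineticPP w + 4 * n * kineticPP w ^ 2 := by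
  have hn' : (n : ℝ) ≠ 0 := Nat.cast_ne_zero.2 hn
  have hS0 : 0 ≤ ∑ i, ‖(w i).2‖ ^ 2 := Finset.sum_nonneg fun i _ => sq_nonneg _
  have hi : ∀ i, ‖(w i).2‖ ^ 2 ≤ ∑ j, ‖(w j).2‖ ^ 2 := fun i =>
    Finset.single_le_sum (f := fun j => ‖(w j).2‖ ^ 2) (fun j _ => sq_nonneg _) (Finset.mem_univ i)
  have hcube : ∀ i, Set.indicator {v : V3 | L < ‖v‖} (fun v => ‖v‖ ^ 3) (w i).2 ≤
      ‖(w i).2‖ ^ 2 * (1 + ∑ j, ‖(w j).2‖ ^ 2) := by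
    intro i
    have h0 : 0 ≤ ‖(w i).2‖ := norm_nonneg _
    have h1 : ‖(w i).2‖ ≤ 1 + ‖(w i).2‖ ^ 2 := by nlinarith [sq_nonneg (‖(w i).2‖ - 1)]
    have h2 : ‖(w i).2‖ ^ 3 ≤ ‖(w i).2‖ ^ 2 * (1 + ∑ j, ‖(w j).2‖ ^ 2) := by
      calc ‖(w i).2‖ ^ 3 = ‖(w i).2‖ ^ 2 * ‖(w i).2‖ := by ring
        _ ≤ ‖(w i).2‖ ^ 2 * (1 + ∑ j, ‖(w j).2‖ ^ 2) :=
            mul_le_mul_of_nonneg_left (h1.trans (by linarith [hi i])) (sq_nonneg _)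
    rw [Set.indicator_apply]
    split_ifs
    · exact h2
    · exact mul_nonneg (sq_nonneg _) (by linarith)
  have hsum : (∑ i, Set.indicator {v : V3 | L < ‖v‖} (fun v => ‖v‖ ^ 3) (w i).2) ≤
      (∑ j, ‖(w j).2‖ ^ 2) * (1 + ∑ j, ‖(w j).2‖ ^ 2) := by
    calc (∑ i, Set.indicator {v : V3 | L < ‖v‖} (fun v => ‖v‖ ^ 3) (w i).2)
        ≤ ∑ i, ‖(w i).2‖ ^ 2 * (1 + ∑ j, ‖(w j).2‖ ^ 2) := Finset.sum_le_sum fun i _ => hcube i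
      _ = (∑ j, ‖(w j).2‖ ^ 2) * (1 + ∑ j, ‖(w j).2‖ ^ 2) := by rw [← Finset.sum_mul]
  have hK : kineticPP w = (n : ℝ)⁻¹ * ((∑ j, ‖(w j).2‖ ^ 2) / 2) := by
    unfold kineticPP
    rw [Finset.sum_div]
  unfold cubicTail
  rw [hK]
  calc (n : ℝ)⁻¹ * ∑ i, Set.indicator {v : V3 | L < ‖v‖} (fun v => ‖v‖ ^ 3) (w i).2
      ≤ (n : ℝ)⁻¹ * ((∑ j, ‖(w j).2‖ ^ 2) * (1 + ∑ j, ‖(w j).2‖ ^ 2)) :=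
        mul_le_mul_of_nonneg_left hsum (inv_nonneg.2 (Nat.cast_nonneg n))
    _ = 2 * ((n : ℝ)⁻¹ * ((∑ j, ‖(w j).2‖ ^ 2) / 2)) +
          4 * n * ((n : ℝ)⁻¹ * ((∑ j, ‖(w j).2‖ ^ 2) / 2)) ^ 2 := by
        field_simp
        ring

/-- **Fubini along the flow for a clamped-measurable family.** If `Y r w` agrees on `[0, t]` with a jointly
measurable `Yc (r, w)` (typically `Yc (r, w) = Y (max 0 (min r t)) w`) and `|Y r (Φ_r z)| ≤ g z` for
`r ∈ [0, b] ⊆ [0, t]`, good `z`, `g ∈ L¹(P)`, then on `[0, b]`: the time integral of `Y` along the flow is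
`P`-integrable, every slice is, `r ↦ E_P Y r (Φ_r ·)` is interval integrable and the iterated integrals agree
(`integral_integral_flow_swap` for `Yc`, then congruence on `[0, b]`). [folklore] -/
theorem xw_flow_swap {ε : ℝ} {n : ℕ} (Φ : HardSphereFlow (Torus.geometry (Fin 3)) ε n)
    (P : Measure (Config n (Fin 3) T3)) [IsFiniteMeasure P] (hP : P ≪ liouville (Torus.geometry (Fin 3)) n ε)
    {t b : ℝ} (hb0 : 0 ≤ b) (hbt : b ≤ t) {Yc : ℝ × Config n (Fin 3) T3 → ℝ} (hYc : Measurable Yc)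
    {Y : ℝ → Config n (Fin 3) T3 → ℝ} (hYY : ∀ r ∈ Set.Icc 0 t, ∀ w, Yc (r, w) = Y r w)
    {g : Config n (Fin 3) T3 → ℝ} (hg : Integrable g P)
    (hdom : ∀ r ∈ Set.Icc 0 b, ∀ z ∈ Φ.good, |Y r (Φ.flow r z)| ≤ g z) :
    Integrable (fun z => ∫ r in (0 : ℝ)..b, Y r (Φ.flow r z)) P ∧
      (∀ r ∈ Set.Icc 0 b, Integrable (fun z => Y r (Φ.flow r z)) P) ∧
      IntervalIntegrable (fun r => ∫ z, Y r (Φ.flow r z) ∂P) volume 0 b ∧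
      ∫ z, (∫ r in (0 : ℝ)..b, Y r (Φ.flow r z)) ∂P = ∫ r in (0 : ℝ)..b, ∫ z, Y r (Φ.flow r z) ∂P := by
  have hsub : Set.Icc 0 b ⊆ Set.Icc 0 t := Set.Icc_subset_Icc_right hbt
  have hYY' : ∀ r ∈ Set.Icc 0 b, ∀ w, Yc (r, w) = Y r w := fun r hr w => hYY r (hsub hr) w
  obtain ⟨h1, h2, h3, h4⟩ := integral_integral_flow_swap Φ P hP hYc hb0 hg fun r hr z hz => by
    rw [hYY' r hr]
    exact hdom r hr z hz
  have hinner : ∀ z, (∫ r in (0 : ℝ)..b, Yc (r, Φ.flow r z)) = ∫ r in (0 : ℝ)..b, Y r (Φ.flow r z) :=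
    fun z => intervalIntegral.integral_congr fun r hr => hYY' r (by rwa [Set.uIcc_of_le hb0] at hr) _
  have houter : ∀ r ∈ Set.Icc 0 b, (∫ z, Yc (r, Φ.flow r z) ∂P) = ∫ z, Y r (Φ.flow r z) ∂P :=
    fun r hr => integral_congr_ae (Eventually.of_forall fun z => hYY' r hr _)
  refine ⟨h1.congr (Eventually.of_forall hinner),
    fun r hr => (h2 r hr).congr (Eventually.of_forall fun z => hYY' r hr _), ?_, ?_⟩
  · exact h3.congr fun r hr => houter r
      (by rw [Set.uIoc_of_le hb0] at hr; exact Set.Ioc_subset_Icc_self hr)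
  · calc ∫ z, (∫ r in (0 : ℝ)..b, Y r (Φ.flow r z)) ∂P
        = ∫ z, (∫ r in (0 : ℝ)..b, Yc (r, Φ.flow r z)) ∂P :=
          (integral_congr_ae (Eventually.of_forall hinner)).symm
      _ = ∫ r in (0 : ℝ)..b, ∫ z, Yc (r, Φ.flow r z) ∂P := h4
      _ = ∫ r in (0 : ℝ)..b, ∫ z, Y r (Φ.flow r z) ∂P :=
          intervalIntegral.integral_congr fun r hr => houter r (by rwa [Set.uIcc_of_le hb0] at hr)

/-- **Arithmetic core of the grid inequality.** From the window estimate
`D₁ − D₀ ≤ C₁(1+L)·EIF + C₁·EIT + 2d + 6τω(1+EK) + 2CX·BAD + C t·PG` with `EIF ≤ β·ID + βκτ`, `EIT ≤ τ·Tl`,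
`0 ≤ C₁ ≤ C`, `τ ≤ t` and the evident signs:
`D₁ ≤ max 0 D₀ + C(1+L)βκt + C t Tl + 2d + 6tω(1+EK) + 2CX·BAD + C t·PG + C(1+L)β·ID`. [folklore] -/
theorem xw_grid_core {D1 D0 EIF EIT EK BAD PG C₁ C L β κ τ t Tl d ω ID CX : ℝ}
    (h : D1 - D0 ≤ C₁ * (1 + L) * EIF + C₁ * EIT + 2 * d + 6 * τ * ω * (1 + EK) + 2 * CX * BAD + C * t * PG)
    (hC₁ : 0 ≤ C₁) (hC : C₁ ≤ C) (hL : 1 ≤ L) (hEIF : 0 ≤ EIF) (hEIT : 0 ≤ EIT)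
    (hF : EIF ≤ β * ID + β * κ * τ) (hT : EIT ≤ τ * Tl) (hτt : τ ≤ t) (hTl : 0 ≤ Tl)
    (hβ : 0 ≤ β) (hκ : 0 ≤ κ) (hω : 0 ≤ ω) (hEK : 0 ≤ EK) :
    D1 ≤ (max 0 D0 + C * (1 + L) * β * κ * t + C * t * Tl + 2 * d + 6 * t * ω * (1 + EK) + 2 * CX * BAD +
      C * t * PG) + C * (1 + L) * β * ID := by
  have hC0 : 0 ≤ C := hC₁.trans hC
  have hL0 : 0 ≤ 1 + L := by linarith
  have hCL : 0 ≤ C * (1 + L) := mul_nonneg hC0 hL0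
  have h1 : C₁ * (1 + L) * EIF ≤ C * (1 + L) * EIF :=
    mul_le_mul_of_nonneg_right (mul_le_mul_of_nonneg_right hC hL0) hEIF
  have h2 : C * (1 + L) * EIF ≤ C * (1 + L) * (β * ID + β * κ * τ) := mul_le_mul_of_nonneg_left hF hCL
  have h3 : C * (1 + L) * (β * κ * τ) ≤ C * (1 + L) * (β * κ * t) :=
    mul_le_mul_of_nonneg_left (mul_le_mul_of_nonneg_left hτt (mul_nonneg hβ hκ)) hCL
  have h4 : C₁ * EIT ≤ C * EIT := mul_le_mul_of_nonneg_right hC hEIT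
  have h5 : C * EIT ≤ C * (τ * Tl) := mul_le_mul_of_nonneg_left hT hC0
  have h6 : C * (τ * Tl) ≤ C * (t * Tl) :=
    mul_le_mul_of_nonneg_left (mul_le_mul_of_nonneg_right hτt hTl) hC0
  have h7 : 6 * τ * ω * (1 + EK) ≤ 6 * t * ω * (1 + EK) :=
    mul_le_mul_of_nonneg_right (mul_le_mul_of_nonneg_right
      (mul_le_mul_of_nonneg_left hτt (by norm_num)) hω) (by linarith)
  have h8 : D0 ≤ max 0 D0 := le_max_right _ _
  linarith

/-! ## The registered stub -/

/-- **Registered stub `grid_increments` (package of `stub_dynamic`): the grid integral inequality of Yau's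
relative-entropy Grönwall, windows from time `0` to the grid points.**  Along a classical hard-sphere–Euler
solution in the analyticity band on `[0, t]` there is `C > 0` such that for every flow `Φ` of `n ≠ 0`
spheres, every probability law `P ≪ Liouville` with the stated integrability / measurability / crude bounds,
radius `0 < ℓ < 1/2`, level `L ≥ 1`, modulus `ω`, cubic-tail bound `Tl`, measurable good event `G'` (packing
cap on `[0, t]`, defects of the windows `[0, (k+1)τ]` at most `d`, `τ = t/ι`) and the entropy domination
`E_P[fluctuationE_r ∘ Φ_r] ≤ β (D(r) + κ′)` on `[0, t]`: the deficit `D(r) = m^{st}(r) − E_P[X_r ∘ Φ_r]` is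
interval-integrable on `[0, t]` and, for every `k ≤ ι`,
`D(kτ) ≤ max 0 D(0) + C(1+L)βκ′t + C t Tl + 2d + 6tω(1 + E_P K) + 2CX E_P[(1+K); G'ᶜ] + C t P(G'ᶜ)
 + C(1+L)β ∫_0^{kτ} D`.
Proof: `window_pathwise` on `[0, kτ]` feeds `window_estimate`; Fubini along the flow (`xw_flow_swap`) and the
domination hypothesis price the fluctuation integral by `β ∫_0^{kτ}(D + κ′)`, the cubic tail by `kτ · Tl`;
the Euler side bounds `|m^{st}(kτ) − m^{st}(0)| ≤ C t`; `k = 0` is trivial. [cite: Yau1991, §2] -/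
theorem grid_increments : ∀ {η₀ : ℝ} {F : ℝ → ℝ}, 0 < η₀ → AnalyticOnNhd ℝ F (Set.Ioo (-η₀) η₀) → Set.EqOn hsExcessFreeEnergy F (Set.Ico 0 η₀) → ∀ {σ T : ℝ}, 0 < σ → ∀ {ρ θ : ℝ → T3 → ℝ} {u : ℝ → T3 → V3}, IsHardSphereEulerSolution σ T ρ u θ → ∀ {t : ℝ}, t ∈ Set.Ico 0 T → 0 < t → (∀ s ∈ Set.Icc 0 t, ∀ x, ρ s x * σ ^ 3 < η₀) → ∀ {η₁ : ℝ}, 0 < η₁ → η₁ < η₀ → ∃ C : ℝ, 0 < C ∧ ∀ {ε : ℝ} {n : ℕ} (Φ : HardSphereFlow (Torus.geometry (Fin 3)) ε n), n ≠ 0 → ∀ (P : Measure (Config n (Fin 3) T3)) [IsProbabilityMeasure P], P ≪ liouville (Torus.geometry (Fin 3)) n ε → (∀ r ∈ Set.Icc 0 t, Integrable (fun z => logProfileObs σ ρ θ u r (Φ.flow r z)) P) → Measurable (fun p : ℝ × Config n (Fin 3) T3 => logProfileObs σ ρ θ u (max 0 (min p.1 t)) p.2) → ∀ {CX : ℝ},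 0 ≤ CX → (∀ r ∈ Set.Icc 0 t, ∀ w : Config n (Fin 3) T3, |logProfileObs σ ρ θ u r w| ≤ CX * (1 + kineticPP w)) → Integrable (fun z => kineticPP z) P → Integrable (fun z => kineticPP z ^ 2) P → Measurable (fun w : Config n (Fin 3) T3 => kineticPP w) → ∀ {ℓ : ℝ}, 0 < ℓ → ℓ < 1 / 2 → ∀ {L : ℝ}, 1 ≤ L → ∀ {ω : ℝ}, 0 ≤ ω → (∀ r ∈ Set.Icc 0 t, ∀ x y : T3, Torus.euclidDist x y < ℓ → |Torus.timeDerivWithin (Set.Ico 0 T) (lam0Row σ ρ θ u) r x - Torus.timeDerivWithin (Set.Ico 0 T) (lam0Row σ ρ θ u) r y| ≤ ω ∧ ‖Torus.timeDerivWithin (Set.Ico 0 T) (lamRow θ u) r x - Torus.timeDerivWithin (Set.Ico 0 T) (lamRow θ u) r y‖ ≤ ω ∧ |Torus.timeDerivWithin (Set.Ico 0 T) (lam4Row θ) r x - Torus.timeDerivWithin (Set.Ico 0 T) (lam4Row θ) r y| ≤ ω ∧ ∀ k, |Torus.partialDeriv k (lam0Row σ ρ θ u r) x - Torus.partialDeriv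 k (lam0Row σ ρ θ u r) y| ≤ ω) → Measurable (fun p : ℝ × Config n (Fin 3) T3 => fluctuationE ℓ (ρ (max 0 (min p.1 t))) (θ (max 0 (min p.1 t))) (u (max 0 (min p.1 t))) p.2) → (∀ r ∈ Set.Icc 0 t, ∀ z ∈ Φ.good, IntervalIntegrable (fun r' => fluctuationE ℓ (ρ r') (θ r') (u r') (Φ.flow r' z)) volume 0 r ∧ IntervalIntegrable (fun r' => cubicTail L (Φ.flow r' z)) volume 0 r) → (∀ r ∈ Set.Icc 0 t, ∀ w : Config n (Fin 3) T3, fluctuationE ℓ (ρ r) (θ r) (u r) w ≤ 2 + kineticPP w) → Measurable (fun w : Config n (Fin 3) T3 => cubicTail L w) → ∀ {Tl : ℝ}, 0 ≤ Tl → (∀ r ∈ Set.Icc 0 t, Integrable (fun z => cubicTail L (Φ.flow r z)) P ∧ ∫ z, cubicTail L (Φ.flow r z) ∂P ≤ Tl) → ∀ (G' : Set (Config n (Fin 3) T3)), MeasurableSet G' → ∀ {d : ℝ}, 0 ≤ d → ∀ {ι : ℕ}, 0 < ι → (∀ z ∈ G', z ∈ Φ.good → packCapOn Φ z (Set.Icc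 0 t) ℓ σ η₁ ∧ ∀ k : ℕ, k < ι → |momDefect σ Φ z ℓ 0 ((k + 1) * (t / ι)) (lamRow θ u)| ≤ d ∧ |enDefect σ Φ z ℓ 0 ((k + 1) * (t / ι)) (lam4Row θ)| ≤ d) → ∀ {β κ' : ℝ}, 0 ≤ β → 0 ≤ κ' → (∀ r ∈ Set.Icc 0 t, ∫ z, fluctuationE ℓ (ρ r) (θ r) (u r) (Φ.flow r z) ∂P ≤ β * (((∫ x, ρ r x * (Real.log (ρ r x) + gChem σ (ρ r x) - 3 / 2 * Real.log (2 * Real.pi * θ r x) - 3 / 2)) - ∫ z, logProfileObs σ ρ θ u r (Φ.flow r z) ∂P) + κ')) → IntervalIntegrable (fun r => (∫ x, ρ r x * (Real.log (ρ r x) + gChem σ (ρ r x) - 3 / 2 * Real.log (2 * Real.pi * θ r x) - 3 / 2)) - ∫ z, logProfileObs σ ρ θ u r (Φ.flow r z) ∂P) volume 0 t ∧ ∀ k : ℕ, k ≤ ι → (∫ x, ρ (k * (t / ι)) x * (Real.log (ρ (k * (t / ι)) x) + gChem σ (ρ (k * (t / ι)) x) - 3 / 2 * Real.log (2 * Real.pi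 * θ (k * (t / ι)) x) - 3 / 2)) - ∫ z, logProfileObs σ ρ θ u (k * (t / ι)) (Φ.flow (k * (t / ι)) z) ∂P ≤ (max 0 ((∫ x, ρ 0 x * (Real.log (ρ 0 x) + gChem σ (ρ 0 x) - 3 / 2 * Real.log (2 * Real.pi * θ 0 x) - 3 / 2)) - ∫ z, logProfileObs σ ρ θ u 0 (Φ.flow 0 z) ∂P) + C * (1 + L) * β * κ' * t + C * t * Tl + 2 * d + 6 * t * ω * (1 + ∫ z, kineticPP z ∂P) + 2 * CX * (∫ z in G'ᶜ, (1 + kineticPP z) ∂P) + C * t * (P G'ᶜ).toReal) + C * (1 + L) * β * ∫ r in (0 : ℝ)..(k * (t / ι)), ((∫ x, ρ r x * (Real.log (ρ r x) + gChem σ (ρ r x) - 3 / 2 * Real.log (2 * Real.pi * θ r x) - 3 / 2)) - ∫ z, logProfileObs σ ρ θ u r (Φ.flow r z) ∂P) := by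
  intro η₀ F hη₀ hFa hEq σ T hσ ρ θ u hE t ht ht0 hband η₁ hη₁ hη₁₀
  -- the constants: the pathwise window constant and a bound of the Euler rate on `[0, t]`
  obtain ⟨C₁, hC₁, hWP⟩ := window_pathwise hη₀ hFa hEq hσ hE ht hband hη₁ hη₁₀
  obtain ⟨hEcont, hEside⟩ := integral_logProfileStatic_sub_eq hη₀ hFa hEq hσ hE ht hband
  obtain ⟨B, hB⟩ := isCompact_Icc.exists_bound_of_continuousOn hEcont
  have hB0 : 0 ≤ B := (norm_nonneg _).trans (hB 0 ⟨le_rfl, ht0.le⟩)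
  refine ⟨C₁ + B, by linarith, ?_⟩
  intro ε n Φ hn P hPm hP hiX hXm CX hCX hXb hiK hiK2 hKm ℓ hℓ0 hℓ L hL ω hω hmod hFm hFI hFb hTm Tl hTl0
    hTl G' hG' d hd ι hι hG β κ' hβ hκ' hdom
  -- abbreviations: the static mean `H` and the deficit `D`
  obtain ⟨H, hH⟩ : ∃ H : ℝ → ℝ, H = fun r => ∫ x, ρ r x * (Real.log (ρ r x) + gChem σ (ρ r x) -
      3 / 2 * Real.log (2 * Real.pi * θ r x) - 3 / 2) := ⟨_, rfl⟩
  obtain ⟨D, hD⟩ : ∃ D : ℝ → ℝ, D = fun r => H r - ∫ z, logProfileObs σ ρ θ u r (Φ.flow r z) ∂P :=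
    ⟨_, rfl⟩
  have hι' : (0 : ℝ) < ι := Nat.cast_pos.2 hι
  have hKflow : ∀ z ∈ Φ.good, ∀ r, kineticPP (Φ.flow r z) = kineticPP z := fun z hz r =>
    wc_kineticPP_flow Φ hz r
  have hclamp : ∀ r ∈ Set.Icc 0 t, max 0 (min r t) = r := fun r hr => by
    rw [min_eq_left hr.2, max_eq_right hr.1]
  have hEK : 0 ≤ ∫ z, kineticPP z ∂P := integral_nonneg fun z => xo_kineticPP_nonneg z
  -- the Euler side: `H b − H 0 = ∫_0^b (Euler rate)`, hence `|H b − H 0| ≤ B b ≤ C t` and `H` is continuous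
  have hEside' : ∀ {b : ℝ}, 0 ≤ b → b ≤ t →
      H b - H 0 = ∫ r in (0 : ℝ)..b, ∫ x, eulerRate σ T ρ θ u r x := by
    intro b hb0 hbt
    simpa only [hH] using hEside le_rfl hb0 hbt
  have hCE : ∀ {b : ℝ}, 0 ≤ b → b ≤ t → |H b - H 0| ≤ (C₁ + B) * t := by
    intro b hb0 hbt
    rw [hEside' hb0 hbt]
    have h1 : ‖∫ r in (0 : ℝ)..b, ∫ x, eulerRate σ T ρ θ u r x‖ ≤ B * |b - 0| :=
      intervalIntegral.norm_integral_le_of_norm_le_const fun r hr => hB r (by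
        rw [Set.uIoc_of_le hb0] at hr
        exact ⟨hr.1.le, hr.2.trans hbt⟩)
    rw [Real.norm_eq_abs, sub_zero, abs_of_nonneg hb0] at h1
    have h2 : B * b ≤ B * t := mul_le_mul_of_nonneg_left hbt hB0
    nlinarith [mul_nonneg hC₁.le ht0.le]
  have hHcont : ContinuousOn H (Set.Icc 0 t) := by
    have hprim : ContinuousOn (fun b => ∫ r in (0 : ℝ)..b, ∫ x, eulerRate σ T ρ θ u r x) (Set.Icc 0 t) := by
      have h := intervalIntegral.continuousOn_primitive_interval (μ := volume) (a := 0) (b := t)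
        (f := fun r => ∫ x, eulerRate σ T ρ θ u r x)
        (by rw [Set.uIcc_of_le ht0.le]; exact hEcont.integrableOn_Icc)
      rwa [Set.uIcc_of_le ht0.le] at h
    refine ((continuousOn_const (c := H 0)).add hprim).congr fun b hb => ?_
    show H b = H 0 + ∫ r in (0 : ℝ)..b, ∫ x, eulerRate σ T ρ θ u r x
    linarith [hEside' hb.1 hb.2]
  -- interval integrability of the deficit on `[0, t]` (Fubini along the flow for `X`)
  have hiK1 : Integrable (fun z => CX * (1 + kineticPP z)) P := ((integrable_const 1).add hiK).const_mul CX
  obtain ⟨-, -, hIIX, -⟩ := xw_flow_swap Φ P hP ht0.le le_rfl hXm (Y := logProfileObs σ ρ θ u)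
    (fun r hr w => by
      show logProfileObs σ ρ θ u (max 0 (min r t)) w = logProfileObs σ ρ θ u r w
      rw [hclamp r hr])
    hiK1 (fun r hr z hz => by rw [← hKflow z hz r]; exact hXb r hr _)
  have hDint : IntervalIntegrable D volume 0 t := by
    rw [hD]
    exact (hHcont.intervalIntegrable_of_Icc ht0.le).sub hIIX
  -- the domination hypothesis in `D`-form
  have hdom' : ∀ r ∈ Set.Icc 0 t,
      ∫ z, fluctuationE ℓ (ρ r) (θ r) (u r) (Φ.flow r z) ∂P ≤ β * (D r + κ') := fun r hr => by
    simpa only [hD, hH] using hdom r hr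
  -- the window step `[0, (k+1)τ]`
  have hstep : ∀ k : ℕ, k < ι → D (((k : ℝ) + 1) * (t / ι)) ≤
      (max 0 (D 0) + (C₁ + B) * (1 + L) * β * κ' * t + (C₁ + B) * t * Tl + 2 * d +
        6 * t * ω * (1 + ∫ z, kineticPP z ∂P) + 2 * CX * (∫ z in G'ᶜ, (1 + kineticPP z) ∂P) +
        (C₁ + B) * t * (P G'ᶜ).toReal) +
      (C₁ + B) * (1 + L) * β * ∫ r in (0 : ℝ)..(((k : ℝ) + 1) * (t / ι)), D r := by
    intro k hk
    set τ' : ℝ := ((k : ℝ) + 1) * (t / ι) with hτ'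
    have hτ'0 : 0 < τ' := mul_pos (by positivity) (div_pos ht0 hι')
    have hτ't : τ' ≤ t := by
      have hk' : (k : ℝ) + 1 ≤ ι := by exact_mod_cast Nat.succ_le_of_lt hk
      calc τ' = ((k : ℝ) + 1) * (t / ι) := hτ'
        _ ≤ (ι : ℝ) * (t / ι) := mul_le_mul_of_nonneg_right hk' (div_nonneg ht0.le hι'.le)
        _ = t := mul_div_cancel₀ t hι'.ne'
    have hsub : Set.Icc 0 τ' ⊆ Set.Icc 0 t := Set.Icc_subset_Icc_right hτ't
    -- Fubini along the flow for the fluctuation and the cubic tail on `[0, τ']`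
    have hg2 : Integrable (fun z => 2 + kineticPP z) P := (integrable_const 2).add hiK
    obtain ⟨hiF, -, hIIF, hswF⟩ := xw_flow_swap Φ P hP hτ'0.le hτ't hFm
      (Y := fun r w => fluctuationE ℓ (ρ r) (θ r) (u r) w)
      (fun r hr w => by
        show fluctuationE ℓ (ρ (max 0 (min r t))) (θ (max 0 (min r t))) (u (max 0 (min r t))) w =
          fluctuationE ℓ (ρ r) (θ r) (u r) w
        rw [hclamp r hr])
      hg2 (fun r hr z hz => by
        rw [abs_of_nonneg (fluctuationE_nonneg _ _ _ _ _), ← hKflow z hz r]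
        exact hFb r (hsub hr) _)
    have hgT : Integrable (fun z => 2 * kineticPP z + 4 * n * kineticPP z ^ 2) P :=
      (hiK.const_mul 2).add (hiK2.const_mul _)
    obtain ⟨hiT, -, hIIT, hswT⟩ := xw_flow_swap Φ P hP hτ'0.le hτ't (hTm.comp measurable_snd)
      (Y := fun _ w => cubicTail L w) (fun r hr w => rfl) hgT (fun r hr z hz => by
        rw [abs_of_nonneg (xv_cubicTail_nonneg _ _), ← hKflow z hz r]
        exact xw_cubicTail_le hn L _)
    beta_reduce at hiF hIIF hswF hiT hIIT hswT
    -- the pathwise expansion on the good event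
    have hWP0 := fun {z : Config n (Fin 3) T3} (hz : z ∈ Φ.good) => @hWP ε n Φ z hz hn 0 τ' le_rfl hτ'0
    simp only [zero_add] at hWP0
    have hpath : ∀ z ∈ G', z ∈ Φ.good →
        |logProfileObs σ ρ θ u τ' (Φ.flow τ' z) - logProfileObs σ ρ θ u 0 (Φ.flow 0 z) - (H τ' - H 0) -
            momDefect σ Φ z ℓ 0 τ' (lamRow θ u) - enDefect σ Φ z ℓ 0 τ' (lam4Row θ)| ≤
          C₁ * (1 + L) * (∫ r in (0 : ℝ)..τ', fluctuationE ℓ (ρ r) (θ r) (u r) (Φ.flow r z)) +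
            C₁ * (∫ r in (0 : ℝ)..τ', cubicTail L (Φ.flow r z)) + 6 * τ' * ω * (1 + kineticPP z) ∧
        |momDefect σ Φ z ℓ 0 τ' (lamRow θ u)| ≤ d ∧ |enDefect σ Φ z ℓ 0 τ' (lam4Row θ)| ≤ d := by
      intro z hzG hz
      obtain ⟨hcap, hdef⟩ := hG z hzG hz
      obtain ⟨hM, hEn⟩ := hdef k hk
      refine ⟨?_, hM, hEn⟩
      have h := hWP0 hz hτ't hℓ0 hℓ hL hω (fun r hr => hmod r (hsub hr)) (fun r hr x => hcap r (hsub hr) x)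
        (hFI τ' ⟨hτ'0.le, hτ't⟩ z hz).1 (hFI τ' ⟨hτ'0.le, hτ't⟩ z hz).2
      have hτω : 0 ≤ τ' * ω := mul_nonneg hτ'0.le hω
      have hKz : 0 ≤ kineticPP z := xo_kineticPP_nonneg z
      simp only [hH]
      refine h.trans ?_
      nlinarith [mul_nonneg hτω hKz]
    -- the expectation-level window estimate
    have hWE0 := @window_estimate ε n Φ P hPm hP 0 τ' hτ'0 (logProfileObs σ ρ θ u) H
      (fun r w => fluctuationE ℓ (ρ r) (θ r) (u r) w) (fun _ w => cubicTail L w)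
      (fun z => momDefect σ Φ z ℓ 0 τ' (lamRow θ u)) (fun z => enDefect σ Φ z ℓ 0 τ' (lam4Row θ)) G' hG'
      (C₁ * (1 + L)) C₁ (6 * τ' * ω) CX ((C₁ + B) * t) d
      (mul_nonneg hC₁.le (by linarith)) hC₁.le (by positivity) hCX hd
    simp only [zero_add] at hWE0
    have hWE := hWE0 hpath (fun w => hXb τ' ⟨hτ'0.le, hτ't⟩ w) (fun w => hXb 0 ⟨le_rfl, ht0.le⟩ w)
      (hCE hτ'0.le hτ't) (fun r w => fluctuationE_nonneg _ _ _ _ _) (fun _ w => xv_cubicTail_nonneg L w)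
      (hiX τ' ⟨hτ'0.le, hτ't⟩) (hiX 0 ⟨le_rfl, ht0.le⟩) hiK hiF hiT
      (fun z _ => intervalIntegral.integral_nonneg hτ'0.le fun r _ => fluctuationE_nonneg _ _ _ _ _)
      (fun z _ => intervalIntegral.integral_nonneg hτ'0.le fun r _ => xv_cubicTail_nonneg L _)
    have hWE' : D τ' - D 0 ≤
        C₁ * (1 + L) * (∫ z, (∫ r in (0 : ℝ)..τ', fluctuationE ℓ (ρ r) (θ r) (u r) (Φ.flow r z)) ∂P) +
          C₁ * (∫ z, (∫ r in (0 : ℝ)..τ', cubicTail L (Φ.flow r z)) ∂P) + 2 * d +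
          6 * τ' * ω * (1 + ∫ z, kineticPP z ∂P) + 2 * CX * (∫ z in G'ᶜ, (1 + kineticPP z) ∂P) +
          (C₁ + B) * t * (P G'ᶜ).toReal := by
      simpa only [hD] using hWE
    -- pricing the fluctuation integral by the domination hypothesis, the cubic tail by `Tl`
    have hDτ : IntervalIntegrable D volume 0 τ' :=
      hDint.mono_set (by rw [Set.uIcc_of_le hτ'0.le, Set.uIcc_of_le ht0.le]; exact hsub)
    have hF : (∫ z, (∫ r in (0 : ℝ)..τ', fluctuationE ℓ (ρ r) (θ r) (u r) (Φ.flow r z)) ∂P) ≤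
        β * (∫ r in (0 : ℝ)..τ', D r) + β * κ' * τ' := by
      rw [hswF]
      calc (∫ r in (0 : ℝ)..τ', ∫ z, fluctuationE ℓ (ρ r) (θ r) (u r) (Φ.flow r z) ∂P)
          ≤ ∫ r in (0 : ℝ)..τ', β * (D r + κ') :=
            intervalIntegral.integral_mono_on hτ'0.le hIIF ((hDτ.add intervalIntegrable_const).const_mul β)
              fun r hr => hdom' r (hsub hr)
        _ = β * (∫ r in (0 : ℝ)..τ', D r) + β * κ' * τ' := by
            rw [intervalIntegral.integral_const_mul, intervalIntegral.integral_add hDτ intervalIntegrable_const,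
              intervalIntegral.integral_const, smul_eq_mul, sub_zero]
            ring
    have hT : (∫ z, (∫ r in (0 : ℝ)..τ', cubicTail L (Φ.flow r z)) ∂P) ≤ τ' * Tl := by
      rw [hswT]
      calc (∫ r in (0 : ℝ)..τ', ∫ z, cubicTail L (Φ.flow r z) ∂P) ≤ ∫ r in (0 : ℝ)..τ', Tl :=
            intervalIntegral.integral_mono_on hτ'0.le hIIT intervalIntegrable_const fun r hr => (hTl r (hsub hr)).2
        _ = τ' * Tl := by rw [intervalIntegral.integral_const, smul_eq_mul, sub_zero]
    have hEIF : 0 ≤ ∫ z, (∫ r in (0 : ℝ)..τ', fluctuationE ℓ (ρ r) (θ r) (u r) (Φ.flow r z)) ∂P :=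
      integral_nonneg fun z => intervalIntegral.integral_nonneg hτ'0.le fun r _ => fluctuationE_nonneg _ _ _ _ _
    have hEIT : 0 ≤ ∫ z, (∫ r in (0 : ℝ)..τ', cubicTail L (Φ.flow r z)) ∂P :=
      integral_nonneg fun z => intervalIntegral.integral_nonneg hτ'0.le fun r _ => xv_cubicTail_nonneg L _
    exact xw_grid_core hWE' hC₁.le (by linarith) hL hEIF hEIT hF hT hτ't hTl0 hβ hκ' hω hEK
  -- assembly over the grid
  have key : IntervalIntegrable D volume 0 t ∧ ∀ k : ℕ, k ≤ ι → D (k * (t / ι)) ≤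
      (max 0 (D 0) + (C₁ + B) * (1 + L) * β * κ' * t + (C₁ + B) * t * Tl + 2 * d +
        6 * t * ω * (1 + ∫ z, kineticPP z ∂P) + 2 * CX * (∫ z in G'ᶜ, (1 + kineticPP z) ∂P) +
        (C₁ + B) * t * (P G'ᶜ).toReal) +
      (C₁ + B) * (1 + L) * β * ∫ r in (0 : ℝ)..(k * (t / ι)), D r := by
    refine ⟨hDint, fun k hk => ?_⟩
    rcases Nat.eq_zero_or_pos k with rfl | hk0
    · simp only [Nat.cast_zero, zero_mul, intervalIntegral.integral_same, mul_zero, add_zero]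
      have h1 : D 0 ≤ max 0 (D 0) := le_max_right _ _
      have h2 : 0 ≤ ∫ z in G'ᶜ, (1 + kineticPP z) ∂P :=
        setIntegral_nonneg hG'.compl fun z _ => by linarith [xo_kineticPP_nonneg z]
      have h3 : 0 ≤ (P G'ᶜ).toReal := ENNReal.toReal_nonneg
      have hC0 : 0 ≤ C₁ + B := by linarith
      have hL0 : 0 ≤ 1 + L := by linarith
      have t1 : 0 ≤ (C₁ + B) * (1 + L) * β * κ' * t :=
        mul_nonneg (mul_nonneg (mul_nonneg (mul_nonneg hC0 hL0) hβ) hκ') ht0.le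
      have t2 : 0 ≤ (C₁ + B) * t * Tl := mul_nonneg (mul_nonneg hC0 ht0.le) hTl0
      have t3 : 0 ≤ 6 * t * ω * (1 + ∫ z, kineticPP z ∂P) :=
        mul_nonneg (mul_nonneg (mul_nonneg (by norm_num) ht0.le) hω) (by linarith)
      have t4 : 0 ≤ 2 * CX * (∫ z in G'ᶜ, (1 + kineticPP z) ∂P) := mul_nonneg (mul_nonneg (by norm_num) hCX) h2
      have t5 : 0 ≤ (C₁ + B) * t * (P G'ᶜ).toReal := mul_nonneg (mul_nonneg hC0 ht0.le) h3
      linarith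
    · obtain ⟨j, rfl⟩ := Nat.exists_eq_succ_of_ne_zero hk0.ne'
      have h := hstep j (Nat.lt_of_succ_le hk)
      push_cast
      exact h
  simpa only [hD, hH] using key

end Summit.AtomisticToContinuum.HydrodynamicLimit.Theorems.NearConstantShortTimeHL

end
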